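import Mathlib.LinearAlgebra.ExteriorAlgebra.Basis
import Mathlib.LinearAlgebra.CliffordAlgebra.Contraction
import Mathlib.Tactic.LinearCombination
import Mathlib.Data.Complex.Basic

/-!
# The twelve-plane exterior-algebra model of `H^*(B, ℂ)` (Tier 4, sub-claim A3, seat p5)

`B = A_1 × ⋯ × A_4` is a 12-dimensional complex torus, `H^*(B, ℂ) = ⋀^* H^1(B, ℂ)` (Lange 2023
Prop. 1.1.20 / Hatcher Ex. 3.16), and `H^1(B, ℂ)` has the basis `{a_p, b_p : p ∈ 𝒫}` indexed by the
twelve "planes" `p = (i, ν)` (`a_p = e_{i,τ_ν}`, `b_p = e_{i,τ̄_ν}`): route/T4-A3-p5.md §A5.3.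
We model this by the exterior algebra of the free `ℂ`-module on `Gen ι := ι × Bool` for a finite
type `ι` of planes (`ι = Fin 4 × Fin 3` in the application; nothing below uses `#ι = 12`).

This file: the generators `gen j`, the even central elements `E p = a_p ∧ b_p`, the polarization
class `θ c = Σ c_p • E p`, and the EXPANSION `θ^r = r!·Σ_{|T| = r} c_T E_T` (T4-A3 (A5.3.1)) —
obtained from a multinomial identity for commuting square-zero elements, evaluated inside the
commutative ring `Subalgebra.center ℂ A`.  Everything is kernel-checked; no geometry is asserted:
the identification of this algebra with `H^*(B, ℂ)` is the cited input A0.3(ii) of the prose.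
-/

namespace Summit.Ventures.HodgeRepro2.WeilPlanes

open Finset

/-! ## 1. A multinomial identity for commuting square-zero elements -/

section CommRing

variable {R : Type*} [CommRing R]

/-- `(x + y)^(n+1) = y^(n+1) + (n+1)·x·y^n` when `x² = 0` (binomial theorem truncated). -/
theorem add_pow_succ_of_sq_eq_zero (x y : R) (hx : x ^ 2 = 0) (n : ℕ) :
    (x + y) ^ (n + 1) = y ^ (n + 1) + ((n : R) + 1) * x * y ^ n := by
  induction n with
  | zero => ring
  | succ n ih =>
    rw [pow_succ, ih]
    push_cast
    linear_combination ((n : R) + 1) * y ^ n * hx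

/-- The multinomial identity for pairwise commuting square-zero elements of a commutative
semiring: `(Σ_{p ∈ s} x_p)^r = r!·Σ_{T ⊆ s, |T| = r} ∏_{p ∈ T} x_p` (T4-A3 (A5.3.1), the abstract
form: only multi-indices with all exponents `≤ 1` survive, and their multinomial coefficient
is `r!`). -/
theorem sum_pow_of_sq_eq_zero {ι : Type*} [DecidableEq ι] (s : Finset ι) (x : ι → R)
    (hx : ∀ p ∈ s, x p ^ 2 = 0) (r : ℕ) :
    (∑ p ∈ s, x p) ^ r = (r.factorial : R) * ∑ T ∈ s.powersetCard r, ∏ p ∈ T, x p := by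
  induction s using Finset.induction_on generalizing r with
  | empty =>
    cases r with
    | zero => simp
    | succ r =>
      rw [Finset.powersetCard_eq_empty.mpr (by simp)]
      simp
  | insert a s ha ih =>
    have hxa : x a ^ 2 = 0 := hx a (Finset.mem_insert_self a s)
    have ih' : ∀ r, (∑ p ∈ s, x p) ^ r =
        (r.factorial : R) * ∑ T ∈ s.powersetCard r, ∏ p ∈ T, x p :=
      fun r => ih (fun p hp => hx p (Finset.mem_insert_of_mem hp)) r
    cases r with
    | zero => simp
    | succ r =>
      rw [Finset.sum_insert ha, add_pow_succ_of_sq_eq_zero _ _ hxa, ih', ih',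
        Finset.powersetCard_succ_insert ha, Finset.sum_union, Finset.sum_image]
      · have hprod : ∀ T ∈ s.powersetCard r, ∏ p ∈ insert a T, x p = x a * ∏ p ∈ T, x p := by
          intro T hT
          have : a ∉ T := fun h => ha (Finset.mem_powersetCard.mp hT |>.1 h)
          exact Finset.prod_insert this
        rw [Finset.sum_congr rfl hprod, ← Finset.mul_sum, Nat.factorial_succ]
        push_cast
        ring
      · intro T hT T' hT' h
        have hT1 : a ∉ T := fun h' => ha (Finset.mem_powersetCard.mp hT |>.1 h')
        have hT2 : a ∉ T' := fun h' => ha (Finset.mem_powersetCard.mp hT' |>.1 h')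
        have : (insert a T).erase a = (insert a T').erase a := by rw [h]
        rwa [Finset.erase_insert hT1, Finset.erase_insert hT2] at this
      · rw [Finset.disjoint_left]
        intro T hT hT'
        obtain ⟨T', -, rfl⟩ := Finset.mem_image.mp hT'
        exact ha (Finset.mem_powersetCard.mp hT |>.1 (Finset.mem_insert_self a T'))

end CommRing

/-! ## 2. The model: generators, the even central elements `E p`, the class `θ` -/

section Model

variable (ι : Type*) [DecidableEq ι]

/-- Generator indices: `(p, false) = a_p = e_{i,τ_ν}`, `(p, true) = b_p = e_{i,τ̄_ν}` for the plane
`p = (i, ν)`. -/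
abbrev Gen := ι × Bool

/-- The model of `H^1(B, ℂ)`: the free `ℂ`-module on the 24 generator indices. -/
abbrev V := Gen ι → ℂ

/-- The model of `H^*(B, ℂ) = ⋀^* H^1(B, ℂ)`. -/
abbrev A := ExteriorAlgebra ℂ (V ι)

variable {ι}

/-- The generator `gen j ∈ H^1(B, ℂ)`: the basis vector of index `j`. -/
noncomputable def gen (j : Gen ι) : A ι := ExteriorAlgebra.ι ℂ (Pi.single j (1 : ℂ) : V ι)

/-- `E p = a_p ∧ b_p ∈ H^2(B, ℂ)`, the plane class of `p` (T4-A3 (A5.3): `E_{i,ν}`). -/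
noncomputable def E (p : ι) : A ι := gen (p, false) * gen (p, true)

/-- A generator squares to zero: `x ∧ x = 0`. -/
theorem gen_mul_self (j : Gen ι) : gen j * gen j = 0 := ExteriorAlgebra.ι_sq_zero _

/-- Generators anticommute: `x ∧ y = −y ∧ x`. -/
theorem gen_mul_gen_swap (j k : Gen ι) : gen j * gen k = -(gen k * gen j) := by
  have := ExteriorAlgebra.ι_add_mul_swap (R := ℂ) (Pi.single j (1 : ℂ) : V ι)
    (Pi.single k (1 : ℂ) : V ι)
  unfold gen
  exact eq_neg_of_add_eq_zero_left this

/-- Any generator commutes with `E p` (`E p` has even degree): `x ∧ a ∧ b = a ∧ b ∧ x`. -/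
theorem commute_E_ι (p : ι) (v : V ι) : Commute (E p) (ExteriorAlgebra.ι ℂ v) := by
  unfold E gen
  set a := ExteriorAlgebra.ι ℂ (Pi.single ((p, false) : Gen ι) (1 : ℂ) : V ι)
  set b := ExteriorAlgebra.ι ℂ (Pi.single ((p, true) : Gen ι) (1 : ℂ) : V ι)
  set x := ExteriorAlgebra.ι ℂ v
  have hbx : b * x = -(x * b) :=
    eq_neg_of_add_eq_zero_left (ExteriorAlgebra.ι_add_mul_swap (R := ℂ) _ _)
  have hax : a * x = -(x * a) :=
    eq_neg_of_add_eq_zero_left (ExteriorAlgebra.ι_add_mul_swap (R := ℂ) _ _)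
  show a * b * x = x * (a * b)
  calc a * b * x = a * (b * x) := mul_assoc _ _ _
    _ = -(a * x * b) := by rw [hbx, mul_neg, mul_assoc]
    _ = x * a * b := by rw [hax, neg_mul, neg_neg]
    _ = x * (a * b) := mul_assoc _ _ _

/-- `E p` is central in the exterior algebra. -/
theorem commute_E (p : ι) (x : A ι) : Commute (E p) x := by
  induction x using ExteriorAlgebra.induction with
  | algebraMap r => exact Algebra.commute_algebraMap_right r _
  | ι v => exact commute_E_ι p v
  | mul a b ha hb => exact ha.mul_right hb
  | add a b ha hb => exact ha.add_right hb

/-- `E p` lies in the center of the exterior algebra. -/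
theorem E_mem_center (p : ι) : E p ∈ Subalgebra.center ℂ (A ι) :=
  Subalgebra.mem_center_iff.mpr fun b => (commute_E p b).symm.eq

/-- `E p ∧ a_p = 0` (repeated factor `a_p`). -/
theorem E_mul_gen_false (p : ι) : E p * gen (p, false) = 0 := by
  unfold E
  rw [mul_assoc, gen_mul_gen_swap (p, true) (p, false), mul_neg, ← mul_assoc, gen_mul_self,
    zero_mul, neg_zero]

/-- `E p ∧ b_p = 0` (repeated factor `b_p`). -/
theorem E_mul_gen_true (p : ι) : E p * gen (p, true) = 0 := by
  unfold E
  rw [mul_assoc, gen_mul_self, mul_zero]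

/-- `E p ∧ x = 0` for every generator `x` of the plane `p` (a repeated factor). -/
theorem E_mul_gen (p : ι) (c : Bool) : E p * gen (p, c) = 0 := by
  cases c
  · exact E_mul_gen_false p
  · exact E_mul_gen_true p

/-- `E p ∧ E p = 0`. -/
theorem E_mul_self (p : ι) : E p * E p = 0 := by
  calc E p * E p = E p * (gen (p, false) * gen (p, true)) := rfl
    _ = E p * gen (p, false) * gen (p, true) := (mul_assoc _ _ _).symm
    _ = 0 := by rw [E_mul_gen_false, zero_mul]

/-- `E p` as an element of the (commutative) center of the exterior algebra. -/
noncomputable def Ec (p : ι) : Subalgebra.center ℂ (A ι) := ⟨E p, E_mem_center p⟩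

/-- The underlying element of `Ec p` is `E p`. -/
@[simp] theorem coe_Ec (p : ι) : ((Ec p : Subalgebra.center ℂ (A ι)) : A ι) = E p := rfl

/-- `Ec p` is square-zero in the center. -/
theorem Ec_sq (p : ι) : (Ec p : Subalgebra.center ℂ (A ι)) ^ 2 = 0 := by
  apply Subtype.ext
  simp [pow_two, E_mul_self]

/-- `E_T = ∏_{p ∈ T} E p` (a product of commuting elements; T4-A3 (A5.3)(b)). -/
noncomputable def ET (T : Finset ι) : A ι := ((∏ p ∈ T, Ec p : Subalgebra.center ℂ (A ι)) : A ι)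

/-- `E_∅ = 1`. -/
@[simp] theorem ET_empty : ET (∅ : Finset ι) = 1 := by simp [ET]

/-- `E_{T ∪ {p}} = E p ∧ E_T` for `p ∉ T`. -/
theorem ET_insert {p : ι} {T : Finset ι} (h : p ∉ T) : ET (insert p T) = E p * ET T := by
  simp [ET, Finset.prod_insert h]

/-- `E_{T ⊔ T'} = E_T ∧ E_{T'}` for disjoint `T`, `T'` (T4-A3 (A5.3)(b)). -/
theorem ET_union {T T' : Finset ι} (h : Disjoint T T') : ET (T ∪ T') = ET T * ET T' := by
  simp [ET, Finset.prod_union h]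

/-- `E_T` is central (a product of central elements). -/
theorem commute_ET (T : Finset ι) (x : A ι) : Commute (ET T) x :=
  Subalgebra.mem_center_iff.mp (Subtype.mem _) x |>.symm

/-- `E_T ∧ E_{T'} = 0` as soon as `T` and `T'` share a plane. -/
theorem ET_mul_ET_of_not_disjoint {T T' : Finset ι} (h : ¬ Disjoint T T') : ET T * ET T' = 0 := by
  obtain ⟨p, hp, hp'⟩ := Finset.not_disjoint_iff.mp h
  have h1 : ET T = E p * ET (T.erase p) := by
    rw [← ET_insert (Finset.notMem_erase p T), Finset.insert_erase hp]
  have h2 : ET T' = E p * ET (T'.erase p) := by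
    rw [← ET_insert (Finset.notMem_erase p T'), Finset.insert_erase hp']
  rw [h1, h2, mul_assoc, (commute_E p (ET (T.erase p))).symm.left_comm, ← mul_assoc,
    E_mul_self, zero_mul]

/-- `E_T ∧ x = 0` for a generator `x` of a plane of `T`. -/
theorem ET_mul_gen_of_mem {T : Finset ι} {p : ι} (hp : p ∈ T) (c : Bool) :
    ET T * gen (p, c) = 0 := by
  rw [← Finset.insert_erase hp, ET_insert (Finset.notMem_erase p T), mul_assoc,
    ← (commute_E p (ET (T.erase p))).symm.left_comm (gen (p, c)), E_mul_gen, mul_zero]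

variable [Fintype ι]

/-- The polarization class `θ = Σ_p c_p • E p` of the twelve-plane model (T4-A3 A4.2/A5.3:
`θ = Σ_{(i,ν)} c_{i,ν} E_{i,ν}`). -/
noncomputable def theta (c : ι → ℂ) : A ι := ∑ p, c p • E p

/-- T4-A3 (A5.3.1): `θ^r = r!·Σ_{T ⊆ 𝒫, |T| = r} c_T E_T`, where `c_T = ∏_{p ∈ T} c_p`. -/
theorem theta_pow (c : ι → ℂ) (r : ℕ) :
    theta c ^ r = (r.factorial : ℂ) • ∑ T ∈ (Finset.univ : Finset ι).powersetCard r,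
      (∏ p ∈ T, c p) • ET T := by
  -- work in the commutative ring `center ℂ (A ι)` and push the identity down with `val`
  set x : ι → Subalgebra.center ℂ (A ι) := fun p => c p • Ec p with hx
  have hx2 : ∀ p ∈ (Finset.univ : Finset ι), x p ^ 2 = 0 := by
    intro p _
    simp [hx, smul_pow, Ec_sq]
  have key := sum_pow_of_sq_eq_zero (Finset.univ : Finset ι) x hx2 r
  set val := Subalgebra.val (Subalgebra.center ℂ (A ι)) with hval
  have hθ : theta c = val (∑ p, x p) := by
    simp [theta, hx, hval, map_sum]
  have hT : ∀ T : Finset ι, val (∏ p ∈ T, x p) = (∏ p ∈ T, c p) • ET T := by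
    intro T
    simp only [hx, Finset.prod_smul, map_smul, hval]
    rfl
  calc theta c ^ r = val ((∑ p, x p) ^ r) := by rw [hθ, map_pow]
    _ = val ((r.factorial : Subalgebra.center ℂ (A ι)) *
          ∑ T ∈ (Finset.univ : Finset ι).powersetCard r, ∏ p ∈ T, x p) := by rw [key]
    _ = (r.factorial : ℂ) • ∑ T ∈ (Finset.univ : Finset ι).powersetCard r,
          (∏ p ∈ T, c p) • ET T := by
        rw [map_mul, map_natCast, map_sum, Finset.sum_congr rfl (fun T _ => hT T),
          Algebra.smul_def, map_natCast]

/-! ## 3. Lemma A5.4: `θ^r ∧ w` for a Weil vector `w` -/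

omit [Fintype ι] in
/-- `E_T ∧ w = 0` when some plane of `T` annihilates `w` (e.g. `w = w_σ` and `T` meets the four
planes `(i, ν(σ))`: T4-A3 Lemma A5.4). -/
theorem ET_mul_eq_zero_of_exists {T : Finset ι} {w : A ι} (h : ∃ p ∈ T, E p * w = 0) :
    ET T * w = 0 := by
  obtain ⟨p, hp, hpw⟩ := h
  rw [← Finset.insert_erase hp, ET_insert (Finset.notMem_erase p T), mul_assoc,
    ← (commute_E p (ET (T.erase p))).symm.left_comm w, hpw, mul_zero]

/-- T4-A3 Lemma A5.4, general form: if the planes of `P₀` annihilate `w`, then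
`θ^r ∧ w = r!·Σ_{T ⊆ 𝒫 ∖ P₀, |T| = r} c_T E_T ∧ w`. -/
theorem theta_pow_mul (c : ι → ℂ) (P₀ : Finset ι) (w : A ι) (hw : ∀ p ∈ P₀, E p * w = 0)
    (r : ℕ) :
    theta c ^ r * w = (r.factorial : ℂ) •
      ∑ T ∈ ((Finset.univ : Finset ι) \ P₀).powersetCard r, (∏ p ∈ T, c p) • (ET T * w) := by
  rw [theta_pow, smul_mul_assoc, Finset.sum_mul]
  simp only [smul_mul_assoc]
  congr 1
  symm
  apply Finset.sum_subset (Finset.powersetCard_mono Finset.sdiff_subset)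
  intro T hT hT'
  have hsub : ¬ T ⊆ Finset.univ \ P₀ := fun h =>
    hT' (Finset.mem_powersetCard.mpr ⟨h, (Finset.mem_powersetCard.mp hT).2⟩)
  obtain ⟨p, hpT, hp⟩ := Finset.not_subset.mp hsub
  have hpP : p ∈ P₀ := by simpa using hp
  rw [ET_mul_eq_zero_of_exists ⟨p, hpT, hw p hpP⟩, smul_zero]

/-- T4-A3 Lemma A5.4, the top case: with `I := 𝒫 ∖ P₀` and `r = |I|`,
`θ^{|I|} ∧ w = |I|!·c_I·E_I ∧ w`. -/
theorem theta_pow_card_mul (c : ι → ℂ) (P₀ : Finset ι) (w : A ι) (hw : ∀ p ∈ P₀, E p * w = 0) :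
    theta c ^ ((Finset.univ : Finset ι) \ P₀).card * w =
      ((((Finset.univ : Finset ι) \ P₀).card.factorial : ℂ) *
        ∏ p ∈ (Finset.univ : Finset ι) \ P₀, c p) • (ET (Finset.univ \ P₀) * w) := by
  rw [theta_pow_mul c P₀ w hw, Finset.powersetCard_self, Finset.sum_singleton, smul_smul]

end Model

end Summit.Ventures.HodgeRepro2.WeilPlanes
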